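import Literature.RingTheory.TightClosure.TightClosure
import Mathlib.RingTheory.KrullDimension.Regular
import Mathlib.RingTheory.IntegralClosure.IntegrallyClosed
import Mathlib.RingTheory.Localization.Integer
import Mathlib.RingTheory.Filtration
import Mathlib.RingTheory.LocalRing.RingHom.Basic
import Mathlib.RingTheory.LocalRing.Quotient
import HarnessLib

/-!
# F-rational local domains are normal (Hochster–Huneke)

Topic: `Literature/RingTheory/TightClosure`. PROVED (no named facts):

* `isIntegrallyClosed_of_isTightlyClosed_span_singleton` — a domain in which every principal ideal is
  tightly closed is integrally closed ([HochsterHuneke1990, (5.9)–(5.11)]: the tight closure of a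
  principal ideal `xR` contains its integral closure `x·R̄ ∩ R`, `R̄` the normalization; so if principal
  ideals are tightly closed, `R̄ = R`).
* `IsFRational.isTightlyClosed_span_singleton` — in an F-rational Noetherian local domain (the tree's
  Fedder–Watanabe definition `IsFRational`: every ideal generated by a FULL system of parameters is
  tightly closed) every principal ideal is tightly closed: a non-zero `x ∈ 𝔪` extends to a system of
  parameters `x, t₂, …, t_d` (lift one of `R/xR`, which has dimension `d - 1`), so does
  `x, t₂ⁿ, …, t_dⁿ` for every `n ≥ 1`, hence `(x)^* ⊆ ⋂ₙ (x, t₂ⁿ, …, t_dⁿ) ⊆ ⋂ₙ (xR + 𝔪ⁿ) = xR` by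
  Krull's intersection theorem in `R/xR`.
* `IsFRational.isIntegrallyClosed` — [HochsterHuneke1994, Thm. 4.2 (b)] "An F-rational ring is
  normal", in the local-domain form used by route `FrobeniusLadder` (Summits/ResolutionOfSingularities:
  the stalks of the F-rational models in cruxes `FRationalModification` / `FRationalResolution` are
  normal), together with the inline-clause version `isIntegrallyClosed_of_fRational_clause`.

Printed proof followed ([HochsterHuneke1994, proof of (4.2)]: "(b) follows by the same argument used to
prove that weakly F-regular rings are normal: see (5.10) and (5.11) of [HH4]"): if `t = a/b` is integral
over the domain `R`, the finitely generated `R`-module `R[t]` has a common denominator `c ≠ 0`, so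
`c·tᵐ ∈ R` for all `m`, i.e. `c·aᵐ ∈ bᵐR = (bR)^[m]` for all `m = p^e`; thus `a ∈ (bR)^* = bR` and
`t ∈ R`. Hochster–Huneke's F-rational rings have ALL parameter ideals (height `n`, `n` generators)
tightly closed, so principal ideals of non-zerodivisors are covered by their definition directly; for
the tree's local full-s.o.p. definition the reduction above (Krull intersection) is supplied here.

## References

* [HochsterHuneke1994] M. Hochster, C. Huneke, *F-regularity, test elements, and smooth base change*,
  Trans. AMS 346 (1994), Thm. 4.2 (b) and its proof (p. 10 of the materialised text).
* [HochsterHuneke1990] M. Hochster, C. Huneke, *Tight closure, invariant theory, and the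
  Briançon–Skoda theorem*, J. AMS 3 (1990), (5.9)–(5.11).
-/

namespace Literature.RingTheory.TightClosure

open IsLocalRing

universe u

variable {R : Type u} [CommRing R]

/-! ## Principal ideals tightly closed ⇒ integrally closed (any domain) -/

section Principal

variable [IsDomain R] (p : ℕ) [ExpChar R p]

/-- **Hochster–Huneke**: a domain of exponential characteristic `p` in which every principal ideal is
tightly closed is integrally closed (normal). Proof: for `t = a/b` integral over `R`, a common
denominator `c ≠ 0` of the finitely generated `R`-module `R[t]` gives `c·aᵐ ∈ bᵐ R` for all `m`, so
`a ∈ (bR)^* = bR`. [cite: HochsterHuneke1990, (5.9)–(5.11); HochsterHuneke1994 Thm. 4.2 (b)] -/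
theorem isIntegrallyClosed_of_isTightlyClosed_span_singleton
    (h : ∀ x : R, IsTightlyClosed p (Ideal.span {x})) : IsIntegrallyClosed R := by
  classical
  let K := FractionRing R
  refine (isIntegrallyClosed_iff K).mpr fun {t} ht => ?_
  -- write `t = a / b`
  obtain ⟨a, b, hb, rfl⟩ := IsFractionRing.div_surjective (A := R) t
  have hb0 : b ≠ 0 := nonZeroDivisors.ne_zero hb
  have hbK : (algebraMap R K b) ≠ 0 :=
    IsFractionRing.to_map_ne_zero_of_mem_nonZeroDivisors hb
  set t := algebraMap R K a / algebraMap R K b with ht_def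
  -- a common denominator `c` for the finitely generated module `R[t]`
  obtain ⟨s, hs⟩ := ht.fg_adjoin_singleton
  obtain ⟨⟨c, hc⟩, hcs⟩ :=
    IsLocalization.exist_integer_multiples_of_finset (nonZeroDivisors R) (S := K) s
  have hc0 : c ≠ 0 := nonZeroDivisors.ne_zero hc
  -- every element of `R[t]` becomes integral after multiplication by `c`
  have hint : ∀ u ∈ Subalgebra.toSubmodule (Algebra.adjoin R {t}),
      IsLocalization.IsInteger R (c • u) := by
    intro u hu
    rw [← hs] at hu
    refine Submodule.span_induction (p := fun u _ => IsLocalization.IsInteger R (c • u))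
      (fun u hu => hcs u hu) ?_ ?_ ?_ hu
    · rw [smul_zero]; exact IsLocalization.isInteger_zero
    · intro u v _ _ hu hv
      rw [smul_add]; exact IsLocalization.isInteger_add hu hv
    · intro r u _ hu
      rw [smul_comm]; exact IsLocalization.isInteger_smul hu
  -- in particular `c · t^m = algebraMap r_m`
  have hpow : ∀ m : ℕ, ∃ r : R, algebraMap R K r = algebraMap R K c * t ^ m := by
    intro m
    obtain ⟨r, hr⟩ := hint (t ^ m)
      (Subalgebra.pow_mem _ (Algebra.self_mem_adjoin_singleton R t) m)
    exact ⟨r, by rw [hr, Algebra.smul_def]⟩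
  -- hence `c · a^m ∈ (b^m)` in `R`
  have hmem : ∀ m : ℕ, c * a ^ m ∈ Ideal.span {b ^ m} := by
    intro m
    obtain ⟨r, hr⟩ := hpow m
    refine Ideal.mem_span_singleton'.mpr ⟨r, ?_⟩
    apply IsFractionRing.injective R K
    have htb : t * algebraMap R K b = algebraMap R K a := by
      rw [ht_def, div_mul_cancel₀ _ hbK]
    calc algebraMap R K (r * b ^ m)
        = algebraMap R K c * t ^ m * algebraMap R K b ^ m := by rw [map_mul, map_pow, hr]
      _ = algebraMap R K c * (t * algebraMap R K b) ^ m := by ring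
      _ = algebraMap R K (c * a ^ m) := by rw [htb, map_mul, map_pow]
  -- so `a ∈ (bR)^* = bR`
  have ha : a ∈ tightClosure p (Ideal.span {b}) := by
    refine (mem_tightClosure_iff_of_isDomain p).mpr ⟨c, hc0, fun e => ?_⟩
    rw [frobeniusPower_span]
    simpa only [Set.image_singleton] using hmem (p ^ e)
  obtain ⟨r, hr⟩ := Ideal.mem_span_singleton'.mp ((h b).le ha)
  refine ⟨r, ?_⟩
  rw [ht_def, eq_div_iff hbK, ← map_mul, hr]

end Principal

/-! ## Systems of parameters through a given element -/

section Sop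

variable [IsNoetherianRing R] [IsLocalRing R]

/-- The Krull dimension of a Noetherian local ring is a natural number. [folklore] -/
theorem exists_ringKrullDim_eq_nat : ∃ d : ℕ, ringKrullDim R = d := by
  obtain ⟨t, -, hcard⟩ :=
    Ideal.exists_finset_card_eq_height_of_isNoetherianRing (maximalIdeal R)
  refine ⟨t.card, ?_⟩
  have h := IsLocalRing.maximalIdeal_height_eq_ringKrullDim (R := R)
  rw [← hcard] at h
  exact_mod_cast h.symm

/-- **Extending a parameter to a system of parameters, with powers.** In a Noetherian local ring of
dimension `d + 1`, a non-zerodivisor `x ∈ 𝔪` is the first element of systems of parameters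
`x, t₁ⁿ, …, t_dⁿ` for all `n ≥ 1`, with `tᵢ ∈ 𝔪` (lift a system of parameters `t̄` of `R/xR`,
which has dimension `d`). [folklore] -/
theorem exists_isSystemOfParameters_cons {d : ℕ} (hd : ringKrullDim R = (d + 1 : ℕ)) {x : R}
    (hx0 : x ∈ nonZeroDivisors R) (hx : x ∈ maximalIdeal R) :
    ∃ t : Fin d → R, (∀ i, t i ∈ maximalIdeal R) ∧
      ∀ n : ℕ, 0 < n → IsSystemOfParameters (Fin.cons x (fun i => t i ^ n) : Fin (d + 1) → R) := by
  classical
  set I : Ideal R := Ideal.span {x} with hI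
  have hItop : I ≠ ⊤ := fun h =>
    (maximalIdeal.isMaximal R).ne_top (top_le_iff.mp (h ▸ (Ideal.span_le.mpr
      (Set.singleton_subset_iff.mpr hx) : I ≤ maximalIdeal R)))
  haveI : Nontrivial (R ⧸ I) := Ideal.Quotient.nontrivial_iff.mpr hItop
  haveI : IsLocalRing (R ⧸ I) :=
    IsLocalRing.of_surjective' (Ideal.Quotient.mk I) Ideal.Quotient.mk_surjective
  -- `dim R/xR = d`
  have hdim' : ringKrullDim (R ⧸ I) = d := by
    obtain ⟨d', hd'⟩ := exists_ringKrullDim_eq_nat (R := R ⧸ I)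
    have h := ringKrullDim_quotient_span_singleton_succ_eq_ringKrullDim_of_mem_nonZeroDivisors hx0 hx
    rw [← hI, hd', hd] at h
    have h' : (d' + 1 : ℕ) = d + 1 := by exact_mod_cast h
    rw [hd']
    exact_mod_cast Nat.succ_injective h'
  -- a system of parameters of `R/xR`, lifted to `R`
  obtain ⟨tb, htb⟩ := exists_isSystemOfParameters (R := R ⧸ I) hdim'
  choose t ht using fun i => Ideal.Quotient.mk_surjective (tb i)
  have hmk : IsLocalRing.maximalIdeal (R ⧸ I) = (maximalIdeal R).map (Ideal.Quotient.mk I) :=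
    (IsLocalRing.map_maximalIdeal_of_surjective _ Ideal.Quotient.mk_surjective).symm
  -- the lifts are non-units
  have htm : ∀ i, t i ∈ maximalIdeal R := by
    intro i
    have hne : Ideal.span (Set.range tb) ≠ ⊤ := fun h => by
      have := htb.2
      rw [h, Ideal.radical_top] at this
      exact (maximalIdeal.isMaximal (R ⧸ I)).ne_top this.symm
    have hti : tb i ∈ IsLocalRing.maximalIdeal (R ⧸ I) := by
      rw [IsLocalRing.mem_maximalIdeal, mem_nonunits_iff]
      intro hu
      exact hne (Ideal.eq_top_of_isUnit_mem _ (Ideal.subset_span ⟨i, rfl⟩) hu)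
    rw [IsLocalRing.mem_maximalIdeal, mem_nonunits_iff]
    intro hu
    have := hu.map (Ideal.Quotient.mk I)
    rw [ht] at this
    exact (IsLocalRing.mem_maximalIdeal _ |>.mp hti) this
  refine ⟨t, htm, fun n hn => ?_⟩
  refine ⟨hd, ?_⟩
  set J : Ideal R := Ideal.span (Set.range (Fin.cons x (fun i => t i ^ n) : Fin (d + 1) → R))
    with hJ
  -- generators of `J`
  have hxJ : x ∈ J := Ideal.subset_span ⟨0, rfl⟩
  have htJ : ∀ i, t i ^ n ∈ J := fun i => Ideal.subset_span ⟨i.succ, by simp⟩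
  apply le_antisymm
  · -- `rad J ≤ 𝔪` since `J ≤ 𝔪`
    refine (maximalIdeal.isMaximal R).isPrime.radical_le_iff.mpr (Ideal.span_le.mpr ?_)
    rintro _ ⟨i, rfl⟩
    refine Fin.cases ?_ (fun i => ?_) i
    · simpa using hx
    · simpa using Ideal.pow_mem_of_mem _ (htm i) n hn
  · -- `𝔪 ≤ rad J`: modulo `x`, `𝔪̄ = rad (t̄)`
    intro y hy
    have hyb : Ideal.Quotient.mk I y ∈ (Ideal.span (Set.range tb)).radical := by
      rw [htb.2, hmk]
      exact Ideal.mem_map_of_mem _ hy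
    obtain ⟨N, hN⟩ := hyb
    -- `span (range tb) = (span (range t)).map mk`
    have hspan : Ideal.span (Set.range tb) = (Ideal.span (Set.range t)).map (Ideal.Quotient.mk I) := by
      rw [Ideal.map_span, ← Set.range_comp]
      congr 1
      ext i
      simp [ht]
    rw [hspan, ← map_pow, Ideal.mem_map_iff_of_surjective _ Ideal.Quotient.mk_surjective] at hN
    obtain ⟨z, hz, hzy⟩ := hN
    rw [Ideal.Quotient.eq] at hzy
    -- `y^N = z - (z - y^N)` with `z ∈ (t)` and `z - y^N ∈ (x)`, both inside `rad J`
    have hzJ : z ∈ J.radical := by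
      refine (Ideal.span_le.mpr ?_ : Ideal.span (Set.range t) ≤ J.radical) hz
      rintro _ ⟨i, rfl⟩
      exact ⟨n, htJ i⟩
    have hxy : z - y ^ N ∈ J.radical :=
      Ideal.le_radical ((Ideal.span_singleton_le_iff_mem _).mpr hxJ hzy)
    have : y ^ N ∈ J.radical := by
      have := sub_mem hzJ hxy
      rwa [sub_sub_cancel] at this
    exact Ideal.mem_radical_of_pow_mem this

end Sop

/-! ## F-rational local domains: principal ideals are tightly closed; normality -/

section FRational

variable [IsNoetherianRing R] [IsLocalRing R] [IsDomain R] (p : ℕ) [ExpChar R p]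

/-- In an F-rational Noetherian local domain (every ideal generated by a system of parameters is
tightly closed) **every principal ideal is tightly closed**: for `0 ≠ x ∈ 𝔪` and systems of
parameters `x, t₂ⁿ, …, t_dⁿ`, `(x)^* ⊆ ⋂ₙ (x, t₂ⁿ, …, t_dⁿ) ⊆ ⋂ₙ (xR + 𝔪ⁿ) = xR` (Krull's intersection
theorem in `R/xR`). [cite: HochsterHuneke1994, Thm. 4.2 (b) (proof)] -/
theorem IsFRational.isTightlyClosed_span_singleton (hR : IsFRational R p) (x : R) :
    IsTightlyClosed p (Ideal.span {x}) := by
  classical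
  rw [isTightlyClosed_iff_le]
  intro y hy
  by_cases hx0 : x = 0
  · -- `(0)^* = 0` in a domain
    subst hx0
    obtain ⟨c, hc, hcy⟩ := (mem_tightClosure_iff_of_isDomain p).mp hy
    have h0 := hcy 0
    rw [pow_zero, pow_one, frobeniusPower_one, Ideal.span_singleton_zero, Ideal.mem_bot,
      mul_eq_zero] at h0
    rw [Ideal.span_singleton_zero, Ideal.mem_bot]
    exact h0.resolve_left hc
  by_cases hxu : IsUnit x
  · rw [Ideal.span_singleton_eq_top.mpr hxu]; trivial
  have hxm : x ∈ maximalIdeal R := (IsLocalRing.mem_maximalIdeal x).mpr hxu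
  have hxnzd : x ∈ nonZeroDivisors R := mem_nonZeroDivisors_of_ne_zero hx0
  -- `dim R = d + 1`
  obtain ⟨d₀, hd₀⟩ := exists_ringKrullDim_eq_nat (R := R)
  obtain ⟨d, rfl⟩ : ∃ d, d₀ = d + 1 := by
    refine Nat.exists_eq_add_one.mpr (Nat.pos_of_ne_zero ?_)
    rintro rfl
    -- `dim R = 0` contradicts `dim (R/xR) + 1 = dim R` with `R/xR` nontrivial
    have hItop : Ideal.span {x} ≠ (⊤ : Ideal R) := fun h =>
      hxu (Ideal.span_singleton_eq_top.mp h)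
    haveI : Nontrivial (R ⧸ Ideal.span {x}) := Ideal.Quotient.nontrivial_iff.mpr hItop
    haveI : IsLocalRing (R ⧸ Ideal.span {x}) :=
      IsLocalRing.of_surjective' (Ideal.Quotient.mk _) Ideal.Quotient.mk_surjective
    obtain ⟨m, hm⟩ := exists_ringKrullDim_eq_nat (R := R ⧸ Ideal.span {x})
    have h := ringKrullDim_quotient_span_singleton_succ_eq_ringKrullDim_of_mem_nonZeroDivisors
      hxnzd hxm
    rw [hd₀, hm] at h
    have h' : m + 1 = 0 := by exact_mod_cast h
    exact Nat.succ_ne_zero m h'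
  obtain ⟨t, htm, hsop⟩ := exists_isSystemOfParameters_cons hd₀ hxnzd hxm
  -- `y ∈ (x) + 𝔪ⁿ` for every `n ≥ 1`
  have hyn : ∀ n : ℕ, 0 < n → y ∈ Ideal.span {x} ⊔ maximalIdeal R ^ n := by
    intro n hn
    set J : Ideal R := Ideal.span (Set.range (Fin.cons x (fun i => t i ^ n) : Fin (d + 1) → R))
    have hJ : IsTightlyClosed p J := hR _ (hsop n hn)
    have hxJ : Ideal.span {x} ≤ J :=
      (Ideal.span_singleton_le_iff_mem _).mpr (Ideal.subset_span ⟨0, rfl⟩)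
    have hyJ : y ∈ J := hJ.le (tightClosure_mono p hxJ hy)
    refine (Ideal.span_le.mpr ?_ : J ≤ Ideal.span {x} ⊔ maximalIdeal R ^ n) hyJ
    rintro _ ⟨i, rfl⟩
    refine Fin.cases ?_ (fun i => ?_) i
    · exact Ideal.mem_sup_left (Ideal.subset_span (by simp))
    · simpa using Ideal.mem_sup_right (Ideal.pow_mem_pow (htm i) n)
  -- Krull's intersection theorem in `R/xR`
  set I : Ideal R := Ideal.span {x} with hI
  have hItop : I ≠ ⊤ := fun h => hxu (Ideal.span_singleton_eq_top.mp h)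
  haveI : Nontrivial (R ⧸ I) := Ideal.Quotient.nontrivial_iff.mpr hItop
  haveI : IsLocalRing (R ⧸ I) :=
    IsLocalRing.of_surjective' (Ideal.Quotient.mk I) Ideal.Quotient.mk_surjective
  have hmk : (maximalIdeal R).map (Ideal.Quotient.mk I) = IsLocalRing.maximalIdeal (R ⧸ I) :=
    IsLocalRing.map_maximalIdeal_of_surjective _ Ideal.Quotient.mk_surjective
  have hbar : Ideal.Quotient.mk I y ∈ ⨅ n : ℕ, IsLocalRing.maximalIdeal (R ⧸ I) ^ n := by
    refine Ideal.mem_iInf.mpr fun n => ?_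
    rcases Nat.eq_zero_or_pos n with rfl | hn
    · rw [pow_zero, Ideal.one_eq_top]; trivial
    have := Ideal.mem_map_of_mem (Ideal.Quotient.mk I) (hyn n hn)
    rw [Ideal.map_sup, Ideal.map_quotient_self, bot_sup_eq, Ideal.map_pow, hmk] at this
    exact this
  rw [Ideal.iInf_pow_eq_bot_of_isLocalRing _ (maximalIdeal.isMaximal (R ⧸ I)).ne_top,
    Ideal.mem_bot, Ideal.Quotient.eq_zero_iff_mem] at hbar
  exact hbar

/-- **F-rational local domains are normal** ([HochsterHuneke1994, Thm. 4.2 (b)] "An F-rational ring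
is normal", local-domain form): a Noetherian local domain of exponential characteristic `p` in which
every ideal generated by a system of parameters is tightly closed is integrally closed.
[cite: HochsterHuneke1994, Thm. 4.2 (b)] -/
theorem IsFRational.isIntegrallyClosed (hR : IsFRational R p) : IsIntegrallyClosed R :=
  isIntegrallyClosed_of_isTightlyClosed_span_singleton p (hR.isTightlyClosed_span_singleton p)

end FRational

/-- **Normality of F-rational stalks, inline form** (the per-stalk clause of route `FrobeniusLadder`,
cruxes `FRationalModification` / `FRationalResolution`): a Noetherian local domain of prime
characteristic `p` in which every ideal generated by a system of parameters `s` (`dim R` elements with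
`rad (s)` maximal) satisfies `c ≠ 0 ∧ (∀ e, c·y^(p^e) ∈ span {z^(p^e) | z ∈ (s)}) ⇒ y ∈ (s)` is
integrally closed. [cite: HochsterHuneke1994, Thm. 4.2 (b)] -/
theorem isIntegrallyClosed_of_fRational_clause (p : ℕ) [Fact p.Prime] {R : Type u} [CommRing R]
    [IsDomain R] [IsNoetherianRing R] [IsLocalRing R] [CharP R p]
    (h : ∀ d : ℕ, ringKrullDim R = d → ∀ s : Fin d → R,
      (Ideal.span (Set.range s)).radical.IsMaximal → ∀ y c : R, c ≠ 0 →
        (∀ e : ℕ, c * y ^ p ^ e ∈ Ideal.span ((fun z : R => z ^ p ^ e) ''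
          (Ideal.span (Set.range s) : Set R))) → y ∈ Ideal.span (Set.range s)) :
    IsIntegrallyClosed R :=
  ((isFRational_iff_of_isDomain p).mpr h).isIntegrallyClosed p

end Literature.RingTheory.TightClosure
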